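import Literature.Analysis.OperatorTheory.PathKernelDomination
import Literature.Analysis.OperatorTheory.PositiveKernelSpectralTraceTwo
import Literature.Analysis.OperatorTheory.CompactSelfAdjointEigenbasis
import Literature.Analysis.OperatorTheory.PositivityImprovingSpectralGap
import Literature.Analysis.OperatorTheory.JointEigenbasis
import HarnessLib

/-!
# Stub `stub_spectralData` (T3a) of line `Sketch`, crux `PencilRigidity.WeakCouplingHypercubicLimit`

ABSTRACT transfer-matrix spectral data (no gauge theory): for a strongly measurable symmetric kernel `0 < K ≤ C` on a
probability space with countably generated σ-algebra, of positive type against bounded measurable functions, and two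
strongly measurable bounded bond kernels `X_a`, `X_b` dominated by `C_A`, `C_B` times the `r+1`-step path kernel of
`K`, the `L²` transfer operator `A` of `K` (`PositiveKernelTransferOperator.exists_kernelOp`: compact, self-adjoint,
positivity improving) has a countable Hilbert basis of eigenvectors (`CompactSelfAdjointEigenbasis`; countability from
separability of `L²`, `Orthonormal.countable_of_separableSpace`) with eigenvalues `0 ≤ λᵢ` (positive type,
`PathKernelDomination.inner_kernelOp_self_nonneg`), `λᵢ ≤ λ_{i₀} = ‖A‖` (the top eigenvector of
`PositivityImprovingSpectralGap` is a basis eigenvalue, `exists_index_eq_norm`), `0 < λ_{i₀}`, `Σ λᵢ² < ∞`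
(Hilbert–Schmidt, `hasSum_lam_sq`); the bond operators satisfy the kernel-domination bounds `‖Â‖ ≤ C_A λ_{i₀}^{r+1}`
(`norm_kernelOp_le_of_abs_le_pathKernel`); the partition functions grow like `Z_{m+1}^{1/(m+1)} → λ_{i₀}`
(`limsup_rpow_eq_of_hasSum_pow`); and the cyclic integrals with zero, one and two bond insertions are the spectral sums
of `PositiveKernelSpectralTrace{,Two}` (`hasSum_pow_integral_cyclic`, `hasSum_integral_iterate_insert_one/two`) after
the peeling identities `integral_cyclic_insert_one/two` of `HeterogeneousCyclicPeeling`.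

References: M. Reed, B. Simon, *Methods of Modern Mathematical Physics I* (1980), Thm. VI.16, VI.22–23; B. Simon,
*Trace Ideals and Their Applications* (2005), Ch. 3. [folklore]
-/

noncomputable section

open scoped BigOperators Topology InnerProductSpace ENNReal
open MeasureTheory Filter

namespace Summit.QuantumFields.YangMills.Theorems.WeakCouplingHypercubicLimit.TraceNormColdPressure

open Literature.Analysis.OperatorTheory Function Set

/-- `stub_spectralData` (T3a) — **spectral data of a positive-type Hilbert–Schmidt kernel with two bond insertions**
(Reed–Simon I Thm VI.16/VI.22–23; Simon, Trace ideals Ch. 3; the tree toolkit `PositiveKernelTransferOperator`,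
`CompactSelfAdjointEigenbasis`, `PositiveKernelSpectralTrace{,Two}`, `HeterogeneousCyclicPeeling`, `KernelIterateBridge`).
For a strongly measurable symmetric kernel `0 < K ≤ C` on a probability space with countably generated σ-algebra, of
positive type against bounded measurable functions, and two strongly measurable bounded bond kernels `X_a`, `X_b`
dominated by `C_A`, `C_B` times the `r+1`-step path weight of `K`: a countable Hilbert basis `(bᵢ)` of `L²(μ)` of
eigenvectors of the integral operator of `K` with eigenvalues `0 ≤ λᵢ ≤ λ_{i₀}`, `λ_{i₀} > 0`, `Σ λᵢ² < ∞`, the `L²`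
operators `Â`, `B̂` of `X_a`, `X_b` with `‖Â‖ ≤ C_A λ_{i₀}^{r+1}`, `‖B̂‖ ≤ C_B λ_{i₀}^{r+1}`, the growth-rate formula
`limsup_m Z_{m+1}^{1/(m+1)} = λ_{i₀}`, and the trace formulas `Z_{m+2} = Σ λᵢ^{m+2}`, two insertions
`= Σ_{(i,j)} λⱼ^{a+2} λᵢ^{b'+2} ⟪bᵢ, Â bⱼ⟫ ⟪bⱼ, B̂ bᵢ⟫`, one insertion `= Σ λᵢ^{r+a+b'+5} ⟪bᵢ, Â bᵢ⟫` (resp. `B̂`).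
[folklore] -/
theorem stub_spectralData :
    ∀ (X : Type) [MeasurableSpace X] [MeasurableSpace.CountablyGenerated X] (μ : Measure X) [IsProbabilityMeasure μ]
      (K : X → X → ℝ) (C : ℝ), StronglyMeasurable (Function.uncurry K) → (∀ x y, K x y = K y x) →
      (∀ x y, 0 < K x y ∧ K x y ≤ C) →
      (∀ f : X → ℝ, Measurable f → (∀ x, |f x| ≤ 1) → 0 ≤ ∫ x, ∫ y, f x * K x y * f y ∂μ ∂μ) →
    ∀ (r : ℕ) (Xa Xb : X → X → ℝ) (CA CB CX : ℝ), StronglyMeasurable (Function.uncurry Xa) → StronglyMeasurable (Function.uncurry Xb) →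
      (∀ u u', |Xa u u'| ≤ CX ∧ |Xb u u'| ≤ CX) →
      (∀ u u' : X, |Xa u u'| ≤ CA * (∫ v : Fin r → X, ∏ i : Fin (r + 1), K ((Fin.cons u (Fin.snoc v u') : Fin (r + 2) → X) (Fin.castSucc i)) ((Fin.cons u (Fin.snoc v u') : Fin (r + 2) → X) (Fin.succ i)) ∂(Measure.pi fun _ => μ))) →
      (∀ u u' : X, |Xb u u'| ≤ CB * (∫ v : Fin r → X, ∏ i : Fin (r + 1), K ((Fin.cons u (Fin.snoc v u') : Fin (r + 2) → X) (Fin.castSucc i)) ((Fin.cons u (Fin.snoc v u') : Fin (r + 2) → X) (Fin.succ i)) ∂(Measure.pi fun _ => μ))) →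
    ∀ (a b' : ℕ),
    ∃ (ι : Type) (_ : Countable ι) (b : HilbertBasis ι ℝ (Lp ℝ 2 μ)) (lam : ι → ℝ) (i₀ : ι)
      (Aop Bop : Lp ℝ 2 μ →L[ℝ] Lp ℝ 2 μ),
      (∀ i, 0 ≤ lam i ∧ lam i ≤ lam i₀) ∧ 0 < lam i₀ ∧ Summable (fun i => lam i ^ 2) ∧
      ‖Aop‖ ≤ CA * lam i₀ ^ (r + 1) ∧ ‖Bop‖ ≤ CB * lam i₀ ^ (r + 1) ∧
      limsup (fun m : ℕ => (∫ V : Fin (m + 1) → X, ∏ t, K (V t) (V (t + 1)) ∂(Measure.pi fun _ => μ)) ^ (((m : ℝ) + 1)⁻¹))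
        atTop = lam i₀ ∧
      (∀ m : ℕ, HasSum (fun i => lam i ^ (m + 2))
        (∫ V : Fin (m + 2) → X, ∏ t, K (V t) (V (t + 1)) ∂(Measure.pi fun _ => μ))) ∧
      HasSum (fun pr : ι × ι => lam pr.2 ^ (a + 2) * lam pr.1 ^ (b' + 2) *
          inner ℝ (b pr.1) (Aop (b pr.2)) * inner ℝ (b pr.2) (Bop (b pr.1)))
        (∫ V : Fin (1 + (a + 2 + (b' + 1 + 1)) + 1) → X, ∏ t : Fin (1 + (a + 2 + (b' + 1 + 1)) + 1),
          (fun s : ℕ => if s = 0 then Xa else if s = a + 2 + 1 then Xb else fun x x' : X => K x x') (t : ℕ) (V t) (V (t + 1))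
          ∂(Measure.pi fun _ => μ)) ∧
      HasSum (fun i => lam i ^ (r + a + b' + 5) * inner ℝ (b i) (Aop (b i)))
        (∫ V : Fin (1 + (r + a + b' + 4) + 1) → X, Xa (V 0) (V 1) *
          ∏ t : Fin (1 + (r + a + b' + 4)), K (V t.succ) (V (t.succ + 1)) ∂(Measure.pi fun _ => μ)) ∧
      HasSum (fun i => lam i ^ (r + a + b' + 5) * inner ℝ (b i) (Bop (b i)))
        (∫ V : Fin (1 + (r + a + b' + 4) + 1) → X, Xb (V 0) (V 1) *
          ∏ t : Fin (1 + (r + a + b' + 4)), K (V t.succ) (V (t.succ + 1)) ∂(Measure.pi fun _ => μ)) := by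
  intro X _ _ μ _ K C hK hsymm hpos hpt r Xa Xb CA CB CX hXa hXb hbd hdomA hdomB a b'
  -- bounds in norm form, a point of `X`
  have hC : ∀ x y, ‖K x y‖ ≤ C := fun x y => by
    rw [Real.norm_of_nonneg (hpos x y).1.le]; exact (hpos x y).2
  have hpos' : ∀ x y, 0 < K x y := fun x y => (hpos x y).1
  have hCXa : ∀ x y, ‖Xa x y‖ ≤ CX := fun x y => by rw [Real.norm_eq_abs]; exact (hbd x y).1
  have hCXb : ∀ x y, ‖Xb x y‖ ≤ CX := fun x y => by rw [Real.norm_eq_abs]; exact (hbd x y).2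
  obtain ⟨x₀, -⟩ := nonempty_of_measure_ne_zero (μ := μ) (s := univ) (by rw [measure_univ]; exact one_ne_zero)
  have hC0 : 0 ≤ C := (norm_nonneg _).trans (hC x₀ x₀)
  -- the transfer operator and an eigenbasis
  obtain ⟨A, hA⟩ := exists_kernelOp (μ := μ) hK hC
  have hsa := isSelfAdjoint_kernelOp hK hC hsymm hA
  have hcpt := isCompactOperator_kernelOp hC hC0 hA
  have himp := isPositivityImproving_kernelOp hK hC hpos' hA
  have hA0 := kernelOp_ne_zero hK hC hpos' (IsProbabilityMeasure.ne_zero μ) hA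
  obtain ⟨s, b, lam, hbs, hb0⟩ := exists_hilbertBasis_eigenvectors_of_isSelfAdjoint hcpt hsa
  have hb : ∀ i, A (b i) = lam i • b i := fun i => by simpa using hb0 i
  haveI : Fact ((2 : ℝ≥0∞) ≠ ⊤) := ⟨ENNReal.ofNat_ne_top⟩
  have hon : Orthonormal ℝ ((↑) : s → Lp ℝ 2 μ) := hbs ▸ b.orthonormal
  have hcnt : Countable s := (hon.countable_of_separableSpace (𝕜 := ℝ)).to_subtype
  -- non-negative eigenvalues (positive type), the top eigenvalue `λ_{i₀} = ‖A‖ > 0`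
  have hlam0 : ∀ i, 0 ≤ lam i := fun i => by
    rw [lam_eq_inner hb i]; exact inner_kernelOp_self_nonneg hA hpt _
  obtain ⟨ψ, hψ0, hψ⟩ := himp.exists_top_eigenvector_of_isCompactOperator hsa hcpt hA0
  obtain ⟨i₀, hi₀⟩ := exists_index_eq_norm b hsa hb hψ0 hψ
  have hle : ∀ i, lam i ≤ lam i₀ := fun i => (le_abs_self _).trans ((abs_lam_le_norm hb i).trans hi₀.ge)
  have hL0 : 0 < lam i₀ := by rw [hi₀]; exact norm_pos_iff.2 hA0
  have hS := hasSum_lam_sq hK hC hA hb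
  -- the bond operators and the kernel-domination bounds
  obtain ⟨Aop, hAop⟩ := exists_kernelOp (μ := μ) hXa hCXa
  obtain ⟨Bop, hBop⟩ := exists_kernelOp (μ := μ) hXb hCXb
  have hP0 := pathKernel_pos (μ := μ) hK.measurable hC hpos' r x₀ x₀
  have hCA : 0 ≤ CA := nonneg_of_mul_nonneg_left ((abs_nonneg _).trans (hdomA x₀ x₀)) hP0
  have hCB : 0 ≤ CB := nonneg_of_mul_nonneg_left ((abs_nonneg _).trans (hdomB x₀ x₀)) hP0
  have hnA : ‖Aop‖ ≤ CA * lam i₀ ^ (r + 1) := by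
    rw [hi₀]; exact norm_kernelOp_le_of_abs_le_pathKernel hK hC hA hAop r hCA hdomA
  have hnB : ‖Bop‖ ≤ CB * lam i₀ ^ (r + 1) := by
    rw [hi₀]; exact norm_kernelOp_le_of_abs_le_pathKernel hK hC hA hBop r hCB hdomB
  -- the trace formulas
  have h6 : ∀ m : ℕ, HasSum (fun i => lam i ^ (m + 2))
      (∫ V : Fin (m + 2) → X, ∏ t, K (V t) (V (t + 1)) ∂(Measure.pi fun _ => μ)) := fun m =>
    hasSum_pow_integral_cyclic hK hC hsymm hA hb hlam0 m
  have hlimsup := limsup_rpow_eq_of_hasSum_pow hlam0 hle hL0 hS.summable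
    (Z := fun m => ∫ V : Fin (m + 1) → X, ∏ t, K (V t) (V (t + 1)) ∂(Measure.pi fun _ => μ)) fun n => h6 n
  have hmXa : ∀ x y, ‖Xa x y‖ ≤ max CX C := fun x y => (hCXa x y).trans (le_max_left _ _)
  have hmXb : ∀ x y, ‖Xb x y‖ ≤ max CX C := fun x y => (hCXb x y).trans (le_max_left _ _)
  have hmK : ∀ x y, ‖K x y‖ ≤ max CX C := fun x y => (hC x y).trans (le_max_right _ _)
  have hc2 := integral_cyclic_insert_two (ρ := μ) (X := Xa) (X' := Xb) (K := fun x x' => K x x')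
    hXa.measurable hXb.measurable hK.measurable hmXa hmXb hmK (a + 2) (b' + 1)
  have h7 := hasSum_integral_iterate_insert_two hK hC hsymm hA hb hXa hCXa hAop hXb hCXb hBop a b'
  rw [← hc2] at h7
  have hc1a := integral_cyclic_insert_one (ρ := μ) (X := Xa) (K := K) hXa.measurable hK.measurable hmXa hmK
    (r + a + b' + 4)
  have hc1b := integral_cyclic_insert_one (ρ := μ) (X := Xb) (K := K) hXb.measurable hK.measurable hmXb hmK
    (r + a + b' + 4)
  have h8 := hasSum_integral_iterate_insert_one hK hC hsymm hA hb hXa hCXa hAop (r + a + b' + 3)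
  have h9 := hasSum_integral_iterate_insert_one hK hC hsymm hA hb hXb hCXb hBop (r + a + b' + 3)
  rw [show r + a + b' + 3 + 2 = r + a + b' + 5 from rfl, show r + a + b' + 3 + 1 = r + a + b' + 4 from rfl] at h8 h9
  rw [← hc1a] at h8
  rw [← hc1b] at h9
  exact ⟨s, hcnt, b, lam, i₀, Aop, Bop, fun i => ⟨hlam0 i, hle i⟩, hL0, hS.summable, hnA, hnB, hlimsup, h6, h7,
    h8, h9⟩

end Summit.QuantumFields.YangMills.Theorems.WeakCouplingHypercubicLimit.TraceNormColdPressure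

end
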